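import Summits.AtomisticToContinuum.HydrodynamicLimit.Theorems.TwoClocksEquilibriumFastWindowLDBirthT12Zonal
import Literature.Analysis.UnboundedOperators.LinearizedBoltzmannGaussGrowth
import Literature.Analysis.UnboundedOperators.LinearizedBoltzmannKernelActionContinuity
import Literature.Analysis.UnboundedOperators.LinearizedBoltzmannKernelAction
import Literature.Analysis.UnboundedOperators.LinearizedBoltzmannFrequencyBounds
import Mathlib.MeasureTheory.Measure.Haar.Basic
import Mathlib.Analysis.InnerProductSpace.Adjoint
import HarnessLib

/-!
# The zonal (`ℓ = 0`) average commutes with the linearised hard-sphere operator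
# (helpers `t12_hardSphereLinearizedOp_zonalAvg_comm` (Z1), `t12_hardSphereLinearizedOp_radial` (Z1')
# of the line `birth`, crux `TwoClocks.EquilibriumFastWindowLD`, stmt-AtomisticToContinuum-14440;
# infrastructure file 2 of the analytic residue `t12_logLinearPreimage_and_dipoleModulus`)

The corrector analysis behind the registered sub-goal `t12_logLinearPreimage_and_dipoleModulus`
splits the equation `L ψ = g` for the linearised hard-sphere operator `L = hardSphereLinearizedOp`
of `ℝ³` into its angular sectors `ℓ = 0`, `ℓ = 1`, `ℓ ≥ 2`. The decoupling rests on the fact that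
the sector projections commute with `L`. This file proves it for the **zonal projection**
`Π₀ψ(v) := (4π)⁻¹ ∫_{S²} ψ(|v| ω) dσ(ω)` (`zonalAvg ψ v`, a radial function):

* **Z1** (`hardSphereLinearizedOp_zonalAvg`, registered form `t12_hardSphereLinearizedOp_zonalAvg_comm`
  with `zonalAvg` unfolded): for `ψ` measurable of Gaussian growth `|ψ(x)| ≤ C e^{|x|²/4}` (the
  class of `hardSphereLinearizedOp_eq_kernel_sub_of_gaussGrowth`, in which all integrals in `L ψ`
  converge absolutely) and **every** `v`, `L(Π₀ψ)(v) = Π₀(Lψ)(v)`.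
* **Z1'** (`t12_hardSphereLinearizedOp_radial`, no hypothesis at all): `L` maps radial functions to
  radial functions; `zonalAvg` form `zonalAvg_hardSphereLinearizedOp_radial` (`Π₀(Lψ) = Lψ`).

Route (O(3) averaging). The tree has the isotropy `L(ψ ∘ R) = (Lψ) ∘ R` for every linear
isometry `R` (`hardSphereLinearizedOp_comp_linearIsometryEquiv_apply`, CIP 1994 §7.3 p. 209), but
`v ↦ ψ(|v| ω)` is not of the form `ψ ∘ R` uniformly in `v`. We therefore realise `Π₀` as an average
over a `v`-INDEPENDENT family of isometries: the compact group `O(3)`, modelled as Mathlib's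
`unitary (E3 →L[ℝ] E3)` (a topological group once `star = adjoint` is known to be continuous —
`continuousStar_clm`, a local instance; compact as a closed subset of the unit ball of a
finite-dimensional space, `compactSpace_unitary_clm`), with its normalised left Haar measure
`haarMeasure ⊤` (a probability measure). With `haarRot R := R⁻¹` (as a `LinearIsometryEquiv`):
* `integral_haar_comp_eq_of_norm_eq`: `∫ f(R⁻¹v) dR` only depends on `|v|` (left invariance of Haar
  under the reflection exchanging `v, v'` — `Submodule.reflection_sub`; no integrability needed);
* `integral_haar_comp_eq_sphereAvg`: **`∫_{O(3)} f(R⁻¹ v) dR = (4π)⁻¹ ∫_{S²} f(|v|ω) dσ(ω)`** for `f`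
  measurable and bounded on the sphere `|u| = |v|` (average the constant over `ω ∈ S²`, Fubini,
  invariance of `σ` under `R⁻¹`, `integral_sphere_comp_isometry`) — i.e. the push-forward of Haar
  under every orbit map is the normalised surface measure, with no appeal to a uniqueness theorem;
* hence `Π₀ψ(v) = ∫_{O(3)} ψ(R⁻¹v) dR` (`zonalAvg_eq_integral_haar`), and Z1 follows from Fubini in
  `dσ dM dR` (the rotated four-term kernel integrand is dominated by
  `4C(1+|v|)e^{|v|²/4}·(1+|v_*|)e^{|v_*|²/4}`, `abs_kernelIntegrand_four_le`), isotropy, and the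
  orbit identity once more for `Lψ` (measurable and bounded on spheres under Gaussian growth:
  `measurable_hardSphereLinearizedOp_of_gaussGrowth`, `exists_abs_hardSphereLinearizedOp_le_on_sphere`,
  from Grad's splitting `Lψ = Kψ - νψ` with `Kψ`, `ν` continuous).

Also the small `zonalAvg` API used here (`_eq_of_norm_eq`, `_congr`, `_radial`, `_const`); the
linear / sup-bound / measurability API and the `M`-orthogonality bookkeeping are left to a sibling
file. NOT here: the dipole (`ℓ = 1`) commutation Z2 (same device, character `⟪R v̂, v̂⟫`), `ℓ ≥ 2`.
References: Cercignani–Illner–Pulvirenti 1994 §7.3 p. 209 (isotropy of `L`); Grad 1963 §4 (sectors);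
Folland, *A Course in Abstract Harmonic Analysis* §2.6 (invariant measures on `G/K`, here `S²`).
-/
noncomputable section

open MeasureTheory ProbabilityTheory Real Set Filter Metric TopologicalSpace
open scoped ENNReal BigOperators InnerProductSpace

namespace Summit.AtomisticToContinuum.HydrodynamicLimit.Theorems.ClampedCorrectorBirth

open Literature.Analysis.FluidPDE Literature.MathematicalPhysics.KineticTheory
open Literature.Analysis.UnboundedOperators

local notation "E3" => EuclideanSpace ℝ (Fin 3)
local notation "S2" => Metric.sphere (0 : EuclideanSpace ℝ (Fin 3)) 1
local notation "O3" => unitary (EuclideanSpace ℝ (Fin 3) →L[ℝ] EuclideanSpace ℝ (Fin 3))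

/-- The adjoint (`star`) is continuous on the bounded operators of `ℝ³` (it is a linear isometry);
Mathlib has no `ContinuousStar (E →L[𝕜] E)` instance, so this is used as a *local* instance to make
`unitary (E3 →L[ℝ] E3)` a topological group. [folklore] -/
theorem continuousStar_clm : ContinuousStar (E3 →L[ℝ] E3) :=
  ⟨(ContinuousLinearMap.adjoint : (E3 →L[ℝ] E3) ≃ₗᵢ⋆[ℝ] (E3 →L[ℝ] E3)).continuous⟩

attribute [local instance] continuousStar_clm

/-- The orthogonal group `O(3)` (unitary bounded operators of `ℝ³`) is compact: closed and of
operator norm `≤ 1`. [folklore] -/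
theorem isCompact_unitary_clm : IsCompact ((O3 : Submonoid (E3 →L[ℝ] E3)) : Set (E3 →L[ℝ] E3)) := by
  refine Metric.isCompact_of_isClosed_isBounded isClosed_unitary ?_
  refine (Metric.isBounded_iff_subset_closedBall 0).2 ⟨1, fun u hu => ?_⟩
  rw [Metric.mem_closedBall, dist_zero_right]
  refine ContinuousLinearMap.opNorm_le_bound _ zero_le_one fun x => ?_
  rw [one_mul, ContinuousLinearMap.norm_map_of_mem_unitary hu]

/-- `O(3)` is a compact space. [folklore] -/
theorem compactSpace_unitary_clm : CompactSpace O3 := isCompact_iff_compactSpace.1 isCompact_unitary_clm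

attribute [local instance] compactSpace_unitary_clm

local notation "μO" => (MeasureTheory.Measure.haarMeasure (⊤ : PositiveCompacts O3))

/-- The normalised Haar measure of `O(3)` is a probability measure. [folklore] -/
theorem isProbabilityMeasure_haarO3 : IsProbabilityMeasure μO := ⟨Measure.haarMeasure_self⟩

attribute [local instance] isProbabilityMeasure_haarO3

/-- The linear isometry `R⁻¹` of `ℝ³` attached to `R ∈ O(3)` (inverse, so that the *left*-invariant
Haar measure averages orbits). [folklore] -/
def haarRot (R : O3) : E3 ≃ₗᵢ[ℝ] E3 := Unitary.linearIsometryEquiv R⁻¹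

/-- `haarRot R u = R⁻¹ u`. [folklore] -/
theorem haarRot_apply (R : O3) (u : E3) : haarRot R u = ((R⁻¹ : O3) : E3 →L[ℝ] E3) u := rfl

/-- Joint continuity of the action `(R, u) ↦ R⁻¹ u`. [folklore] -/
theorem continuous_haarRot_apply {X : Type*} [TopologicalSpace X] {R : X → O3} {u : X → E3}
    (hR : Continuous R) (hu : Continuous u) : Continuous fun x => haarRot (R x) (u x) := by
  simp_rw [haarRot_apply]
  exact (continuous_subtype_val.comp (continuous_inv.comp hR)).clm_apply hu

/-- **Orbit averages over `O(3)` only depend on the radius**: `∫ f(R⁻¹ v) dR = ∫ f(R⁻¹ v') dR` for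
`|v| = |v'|` (left invariance of Haar under the reflection exchanging `v` and `v'`; no integrability
needed). [folklore] -/
theorem integral_haar_comp_eq_of_norm_eq (f : E3 → ℝ) {v v' : E3} (h : ‖v‖ = ‖v'‖) :
    ∫ R, f (haarRot R v) ∂μO = ∫ R, f (haarRot R v') ∂μO := by
  set B : E3 ≃ₗᵢ[ℝ] E3 := (ℝ ∙ (v' - v))ᗮ.reflection with hBdef
  have hB : B v' = v := Submodule.reflection_sub h.symm
  set b : O3 := Unitary.linearIsometryEquiv.symm B with hbdef
  have key : ∀ R : O3, haarRot (b⁻¹ * R) v' = haarRot R v := by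
    intro R
    rw [haarRot_apply, haarRot_apply, mul_inv_rev, inv_inv, Submonoid.coe_mul, mul_apply_eq_comp]
    exact congr_arg _ hB
  simp_rw [← key]
  exact (measurePreserving_mul_left μO b⁻¹).integral_comp (MeasurableEquiv.mulLeft b⁻¹).measurableEmbedding
    (fun R => f (haarRot R v'))

/-- **Orbit averages over `O(3)` are sphere averages**: for `f` measurable and bounded on the sphere
`|u| = |v|`, `∫_{O(3)} f(R⁻¹ v) dR = (4π)⁻¹ ∫_{S²} f(|v| ω) dσ(ω)` (average the constant orbit
integral over `ω`, Fubini, rotation invariance of `σ`). [folklore] -/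
theorem integral_haar_comp_eq_sphereAvg {f : E3 → ℝ} (hf : Measurable f) (v : E3) {M : ℝ}
    (hM : ∀ ω : S2, |f (‖v‖ • (ω : E3))| ≤ M) :
    ∫ R, f (haarRot R v) ∂μO = (4 * π)⁻¹ * ∫ ω : S2, f (‖v‖ • (ω : E3)) ∂sphereMeasure := by
  haveI := isFiniteMeasure_sphereMeasure (E := E3)
  have h1 : ∀ ω : S2, ∫ R, f (haarRot R (‖v‖ • (ω : E3))) ∂μO = ∫ R, f (haarRot R v) ∂μO := fun ω =>
    integral_haar_comp_eq_of_norm_eq f (by rw [norm_smul, norm_norm, norm_eq_of_mem_sphere ω, mul_one])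
  have hmem : ∀ (R : O3) (ω : S2), haarRot R (ω : E3) ∈ S2 := fun R ω => by
    rw [mem_sphere_zero_iff_norm, LinearIsometryEquiv.norm_map, norm_eq_of_mem_sphere ω]
  have hsmul : ∀ (R : O3) (ω : S2), haarRot R (‖v‖ • (ω : E3)) = ‖v‖ • haarRot R (ω : E3) := fun R ω =>
    map_smul _ _ _
  have hint : Integrable (Function.uncurry fun (ω : S2) (R : O3) => f (haarRot R (‖v‖ • (ω : E3))))
      ((sphereMeasure : Measure S2).prod μO) := by
    refine (integrable_const M).mono' ?_ (Eventually.of_forall fun p => ?_)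
    · have hc : Continuous fun p : S2 × O3 => haarRot p.2 (‖v‖ • (p.1 : E3)) :=
        continuous_haarRot_apply continuous_snd (by fun_prop)
      exact (hf.comp hc.measurable).aestronglyMeasurable
    · rw [Function.uncurry_apply_pair, hsmul, Real.norm_eq_abs]
      exact hM ⟨_, hmem p.2 p.1⟩
  have h2 := integral_integral_swap hint
  simp only [h1] at h2
  rw [integral_const, smul_eq_mul, sphereMeasure_real_univ_fin3] at h2
  have h4 : ∀ R : O3, ∫ ω : S2, f (haarRot R (‖v‖ • (ω : E3))) ∂sphereMeasure =
      ∫ ω : S2, f (‖v‖ • (ω : E3)) ∂sphereMeasure := by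
    intro R
    rw [← integral_sphere_comp_isometry (haarRot R) (fun ω : S2 => f (‖v‖ • (ω : E3)))]
    congr 1 with ω
    rw [hsmul, MapsTo.val_restrict_apply]
  simp only [h4] at h2
  rw [integral_const, smul_eq_mul, probReal_univ, one_mul] at h2
  rw [← h2, ← mul_assoc, inv_mul_cancel₀ (by positivity), one_mul]

/-! ### The zonal (`ℓ = 0`) average -/

/-- **The zonal average** `Π₀ψ(v) := (4π)⁻¹ ∫_{S²} ψ(|v| ω) dσ(ω)` of a function `ψ` on `ℝ³`: the
mean of `ψ` over the sphere `|u| = |v|` (the `ℓ = 0` component of `ψ`, a radial function). Bochner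
integral, junk value `0` where not integrable. [folklore] -/
def zonalAvg (ψ : EuclideanSpace ℝ (Fin 3) → ℝ) (v : EuclideanSpace ℝ (Fin 3)) : ℝ :=
  (4 * Real.pi)⁻¹ * ∫ ω : Metric.sphere (0 : EuclideanSpace ℝ (Fin 3)) 1,
    ψ (‖v‖ • (ω : EuclideanSpace ℝ (Fin 3))) ∂sphereMeasure

/-- The zonal average is radial: it only depends on `|v|`. [folklore] -/
theorem zonalAvg_eq_of_norm_eq (ψ : E3 → ℝ) {v v' : E3} (h : ‖v‖ = ‖v'‖) :
    zonalAvg ψ v = zonalAvg ψ v' := by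
  unfold zonalAvg; rw [h]

/-- Locality: the zonal average at `v` only sees `ψ` on the sphere `|u| = |v|`. [folklore] -/
theorem zonalAvg_congr {ψ₁ ψ₂ : E3 → ℝ} {v : E3}
    (h : ∀ ω : S2, ψ₁ (‖v‖ • (ω : E3)) = ψ₂ (‖v‖ • (ω : E3))) : zonalAvg ψ₁ v = zonalAvg ψ₂ v := by
  unfold zonalAvg; simp_rw [h]

/-- **Radial functions are reproduced**: `Π₀(f ∘ |·|)(v) = f(|v|)`. [folklore] -/
theorem zonalAvg_radial (f : ℝ → ℝ) (v : E3) : zonalAvg (fun u => f ‖u‖) v = f ‖v‖ := by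
  haveI := isFiniteMeasure_sphereMeasure (E := E3)
  unfold zonalAvg
  have : ∀ ω : S2, f ‖‖v‖ • (ω : E3)‖ = f ‖v‖ := fun ω => by
    rw [norm_smul, norm_norm, norm_eq_of_mem_sphere ω, mul_one]
  simp_rw [this]
  rw [integral_const, smul_eq_mul, sphereMeasure_real_univ_fin3, ← mul_assoc,
    inv_mul_cancel₀ (by positivity), one_mul]

/-- Constants are reproduced: `Π₀ c = c`. [folklore] -/
theorem zonalAvg_const (c : ℝ) (v : E3) : zonalAvg (fun _ => c) v = c := zonalAvg_radial (fun _ => c) v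

/-- **The zonal average is the orbit average over `O(3)`**: for `ψ` measurable of Gaussian growth,
`Π₀ψ(v) = ∫_{O(3)} ψ(R⁻¹ v) dR` (normalised Haar measure). This is the device that makes `Π₀`
commute with every rotation-invariant operator. [folklore] -/
theorem zonalAvg_eq_integral_haar {ψ : E3 → ℝ} (hψ : Measurable ψ) {C : ℝ}
    (hC : ∀ x, |ψ x| ≤ C * Real.exp (‖x‖ ^ 2 / 4)) (v : E3) :
    zonalAvg ψ v = ∫ R, ψ (haarRot R v) ∂μO :=
  (integral_haar_comp_eq_sphereAvg hψ v (M := C * Real.exp (‖v‖ ^ 2 / 4)) fun ω => by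
    have := hC (‖v‖ • (ω : E3))
    rwa [norm_smul, norm_norm, norm_eq_of_mem_sphere ω, mul_one] at this).symm

/-- `R ↦ ψ(R⁻¹ u)` is Haar-integrable for `ψ` measurable of Gaussian growth (bounded by
`C e^{|u|²/4}`). [folklore] -/
theorem integrable_haar_comp {ψ : E3 → ℝ} (hψ : Measurable ψ) {C : ℝ}
    (hC : ∀ x, |ψ x| ≤ C * Real.exp (‖x‖ ^ 2 / 4)) (u : E3) :
    Integrable (fun R : O3 => ψ (haarRot R u)) μO := by
  refine (integrable_const (C * Real.exp (‖u‖ ^ 2 / 4))).mono' ?_ (Eventually.of_forall fun R => ?_)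
  · exact (hψ.comp (continuous_haarRot_apply continuous_id continuous_const).measurable).aestronglyMeasurable
  · rw [Real.norm_eq_abs]
    have := hC (haarRot R u)
    rwa [LinearIsometryEquiv.norm_map] at this

/-! ### The linearised operator on functions of Gaussian growth: measurability, sphere bounds -/

/-- `L ψ` is measurable for `ψ` measurable of Gaussian growth (Grad's splitting `L ψ = K ψ - ν ψ`
with `K ψ` strongly measurable and `ν` continuous). [folklore] -/
theorem measurable_hardSphereLinearizedOp_of_gaussGrowth {ψ : E3 → ℝ} (hψ : Measurable ψ) {C : ℝ}
    (hC : ∀ x, |ψ x| ≤ C * Real.exp (‖x‖ ^ 2 / 4)) : Measurable (hardSphereLinearizedOp ψ) := by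
  rw [show hardSphereLinearizedOp ψ = _ from funext (hardSphereLinearizedOp_eq_kernel_sub_of_gaussGrowth hψ hC)]
  exact (stronglyMeasurable_kernelAction_of_measurable hψ).measurable.sub
    ((collisionFrequency_pos_and_continuous (E := E3) (by simp)).2.measurable.mul hψ)

/-- `L ψ` is bounded on every sphere `|u| = r` for `ψ` measurable of Gaussian growth (`K ψ` and `ν`
are continuous, `|ψ| ≤ C e^{r²/4}` there). [folklore] -/
theorem exists_abs_hardSphereLinearizedOp_le_on_sphere {ψ : E3 → ℝ} (hψ : Measurable ψ) {C : ℝ}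
    (hC : ∀ x, |ψ x| ≤ C * Real.exp (‖x‖ ^ 2 / 4)) (r : ℝ) :
    ∃ M : ℝ, ∀ u : E3, ‖u‖ = r → |hardSphereLinearizedOp ψ u| ≤ M := by
  have hC0 : 0 ≤ C := le_trans (abs_nonneg _) ((hC 0).trans (by simp))
  set K : E3 → ℝ := fun v => ∫ w, ∫ ω, hardSphereKernel (v, w) ω *
      (ψ (collide ω (v, w)).1 + ψ (collide ω (v, w)).2 - ψ w) ∂sphereMeasure ∂stdGaussian E3 with hK
  have hKc : Continuous K := continuous_kernelAction_of_gaussGrowth hψ hC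
  have hνc := (collisionFrequency_pos_and_continuous (E := E3) (by simp)).2
  have hgc : Continuous fun u : E3 => ‖K u‖ + ‖collisionFrequency u‖ * (C * Real.exp (‖u‖ ^ 2 / 4)) := by
    fun_prop
  obtain ⟨M, hM⟩ := (isCompact_sphere (0 : E3) r).exists_bound_of_continuousOn hgc.continuousOn
  refine ⟨M, fun u hu => ?_⟩
  have h1 := hM u (mem_sphere_zero_iff_norm.2 hu)
  rw [Real.norm_of_nonneg (by positivity)] at h1
  rw [hardSphereLinearizedOp_eq_kernel_sub_of_gaussGrowth hψ hC u]
  calc |K u - collisionFrequency u * ψ u| ≤ |K u| + |collisionFrequency u * ψ u| := abs_sub _ _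
    _ ≤ ‖K u‖ + ‖collisionFrequency u‖ * (C * Real.exp (‖u‖ ^ 2 / 4)) := by
        rw [abs_mul, ← Real.norm_eq_abs, ← Real.norm_eq_abs]
        exact add_le_add le_rfl (mul_le_mul_of_nonneg_left (hC u) (norm_nonneg _))
    _ ≤ M := h1

/-- The four-term kernel integrand of `ψ ∘ A` (`A` a linear isometry) under Gaussian growth:
`|B (ψ(Av') + ψ(Av_*') - ψ(Av) - ψ(Av_*))| ≤ 4C (1+|v|) e^{|v|²/4} (1+|v_*|) e^{|v_*|²/4}`.
[folklore] -/
theorem abs_kernelIntegrand_four_le {ψ : E3 → ℝ} {C : ℝ} (hC0 : 0 ≤ C)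
    (hC : ∀ x, |ψ x| ≤ C * Real.exp (‖x‖ ^ 2 / 4)) (A : E3 ≃ₗᵢ[ℝ] E3) (v w : E3) (ω : S2) :
    |hardSphereKernel (v, w) ω * (ψ (A (collide ω (v, w)).1) + ψ (A (collide ω (v, w)).2) -
        ψ (A v) - ψ (A w))| ≤
      (4 * C * ((1 + ‖v‖) * Real.exp (‖v‖ ^ 2 / 4))) * ((1 + ‖w‖) * Real.exp (‖w‖ ^ 2 / 4)) := by
  have hC' : ∀ x, |(ψ ∘ A) x| ≤ C * Real.exp (‖x‖ ^ 2 / 4) := fun x => by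
    simpa only [Function.comp_apply, A.norm_map] using hC (A x)
  have h3 := abs_kernelIntegrand_le_of_gaussGrowth hC0 hC' v w ω
  simp only [Function.comp_apply] at h3
  have hB0 : 0 ≤ hardSphereKernel (v, w) ω := le_max_right _ _
  have hB : hardSphereKernel (v, w) ω ≤ (1 + ‖v‖) * (1 + ‖w‖) := by
    refine (hardSphereKernel_le_abs_inner_add_norm v w ω).trans ?_
    nlinarith [abs_inner_sphere_le v ω, norm_nonneg v, norm_nonneg w,
      mul_nonneg (norm_nonneg v) (norm_nonneg w)]
  have h4 : |hardSphereKernel (v, w) ω * ψ (A v)| ≤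
      (C * ((1 + ‖v‖) * Real.exp (‖v‖ ^ 2 / 4))) * ((1 + ‖w‖) * Real.exp (‖w‖ ^ 2 / 4)) := by
    rw [abs_mul, abs_of_nonneg hB0]
    have hv : |ψ (A v)| ≤ C * Real.exp (‖v‖ ^ 2 / 4) := by simpa only [A.norm_map] using hC (A v)
    have hew : 1 ≤ Real.exp (‖w‖ ^ 2 / 4) := Real.one_le_exp (by positivity)
    calc hardSphereKernel (v, w) ω * |ψ (A v)|
        ≤ ((1 + ‖v‖) * (1 + ‖w‖)) * (C * Real.exp (‖v‖ ^ 2 / 4)) :=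
          mul_le_mul hB hv (abs_nonneg _) (by positivity)
      _ ≤ ((1 + ‖v‖) * (1 + ‖w‖)) * (C * Real.exp (‖v‖ ^ 2 / 4)) * Real.exp (‖w‖ ^ 2 / 4) :=
          le_mul_of_one_le_right (by positivity) hew
      _ = _ := by ring
  have hsplit : hardSphereKernel (v, w) ω * (ψ (A (collide ω (v, w)).1) + ψ (A (collide ω (v, w)).2) -
      ψ (A v) - ψ (A w)) =
      hardSphereKernel (v, w) ω * (ψ (A (collide ω (v, w)).1) + ψ (A (collide ω (v, w)).2) - ψ (A w)) -
        hardSphereKernel (v, w) ω * ψ (A v) := by ring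
  rw [hsplit]
  refine (abs_sub _ _).trans ?_
  linarith

/-- Joint measurability of the rotated four-term kernel integrand
`(R, v_*, ω) ↦ B (ψ(R⁻¹v') + ψ(R⁻¹v_*') - ψ(R⁻¹v) - ψ(R⁻¹v_*))` along continuous parameter maps.
[folklore] -/
theorem measurable_kernelIntegrand_haarRot {ψ : E3 → ℝ} (hψ : Measurable ψ) (v : E3) {X : Type*}
    [TopologicalSpace X] [MeasurableSpace X] [OpensMeasurableSpace X] {R : X → O3} {w : X → E3}
    {ω : X → S2} (hR : Continuous R) (hw : Continuous w) (hω : Continuous ω) :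
    Measurable fun x => hardSphereKernel (v, w x) (ω x) *
      (ψ (haarRot (R x) (collide (ω x) (v, w x)).1) + ψ (haarRot (R x) (collide (ω x) (v, w x)).2) -
        ψ (haarRot (R x) v) - ψ (haarRot (R x) (w x))) := by
  have hB : Continuous fun x => hardSphereKernel (v, w x) (ω x) := by
    unfold hardSphereKernel; fun_prop
  have hc1 : Continuous fun x => (collide (ω x) (v, w x)).1 := by unfold collide; fun_prop
  have hc2 : Continuous fun x => (collide (ω x) (v, w x)).2 := by unfold collide; fun_prop
  exact hB.measurable.mul ((((hψ.comp (continuous_haarRot_apply hR hc1).measurable).add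
    (hψ.comp (continuous_haarRot_apply hR hc2).measurable)).sub
    (hψ.comp (continuous_haarRot_apply hR continuous_const).measurable)).sub
    (hψ.comp (continuous_haarRot_apply hR hw).measurable))

/-! ### Z1: the zonal average commutes with `L` -/

/-- **The zonal projection commutes with the linearised hard-sphere operator**: for `ψ` measurable
of Gaussian growth `|ψ| ≤ C e^{|·|²/4}` and every `v`,
`L (Π₀ψ)(v) = Π₀(L ψ)(v) = (4π)⁻¹ ∫_{S²} (Lψ)(|v| ω) dσ(ω)`. Proof: `Π₀ψ = ∫_{O(3)} ψ ∘ R⁻¹ dR`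
(`zonalAvg_eq_integral_haar`), Fubini (the rotated integrand is dominated by
`4C(1+|v|)e^{|v|²/4}(1+|v_*|)e^{|v_*|²/4} ∈ L¹(dσ dM dR)`), isotropy `L(ψ ∘ R⁻¹)(v) = (Lψ)(R⁻¹v)`
(CIP 1994 §7.3), and the orbit-average identity again for `Lψ` (measurable, bounded on spheres).
[folklore] -/
theorem hardSphereLinearizedOp_zonalAvg {ψ : E3 → ℝ} (hψ : Measurable ψ) {C : ℝ}
    (hC : ∀ x, |ψ x| ≤ C * Real.exp (‖x‖ ^ 2 / 4)) (v : E3) :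
    hardSphereLinearizedOp (zonalAvg ψ) v = zonalAvg (hardSphereLinearizedOp ψ) v := by
  haveI := isFiniteMeasure_sphereMeasure (E := E3)
  have hC0 : 0 ≤ C := le_trans (abs_nonneg _) ((hC 0).trans (by simp))
  set F : O3 → E3 → S2 → ℝ := fun R w ω => hardSphereKernel (v, w) ω *
    (ψ (haarRot R (collide ω (v, w)).1) + ψ (haarRot R (collide ω (v, w)).2) -
      ψ (haarRot R v) - ψ (haarRot R w)) with hF
  have hFb : ∀ R w ω, |F R w ω| ≤
      (4 * C * ((1 + ‖v‖) * Real.exp (‖v‖ ^ 2 / 4))) * ((1 + ‖w‖) * Real.exp (‖w‖ ^ 2 / 4)) :=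
    fun R w ω => abs_kernelIntegrand_four_le hC0 hC (haarRot R) v w ω
  -- the integrand of `L (Π₀ψ) v` is the Haar average of `F`; Fubini twice; isotropy; orbit average
  have hI := integrable_haar_comp hψ hC
  have h1 : hardSphereLinearizedOp (zonalAvg ψ) v = ∫ w, ∫ ω, ∫ R, F R w ω ∂μO ∂sphereMeasure
      ∂stdGaussian E3 := by
    unfold hardSphereLinearizedOp linearizedCollisionOp
    congr 1 with w
    congr 1 with ω
    rw [zonalAvg_eq_integral_haar hψ hC, zonalAvg_eq_integral_haar hψ hC,
      zonalAvg_eq_integral_haar hψ hC, zonalAvg_eq_integral_haar hψ hC]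
    symm
    rw [integral_const_mul, integral_sub ?_ (hI w), integral_sub ?_ (hI v), integral_add (hI _) (hI _)]
    · exact (hI _).add (hI _)
    · exact ((hI _).add (hI _)).sub (hI _)
  have h2 : ∀ w, ∫ ω, ∫ R, F R w ω ∂μO ∂(sphereMeasure : Measure S2) =
      ∫ R, ∫ ω, F R w ω ∂(sphereMeasure : Measure S2) ∂μO := by
    intro w
    refine integral_integral_swap ((integrable_const ((4 * C * ((1 + ‖v‖) * Real.exp (‖v‖ ^ 2 / 4))) *
      ((1 + ‖w‖) * Real.exp (‖w‖ ^ 2 / 4)))).mono' ?_ (Eventually.of_forall fun p => ?_))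
    · exact (measurable_kernelIntegrand_haarRot hψ v continuous_snd continuous_const
        continuous_fst).aestronglyMeasurable
    · rw [Real.norm_eq_abs]; exact hFb p.2 w p.1
  have h3 : ∫ w, ∫ R, ∫ ω, F R w ω ∂(sphereMeasure : Measure S2) ∂μO ∂stdGaussian E3 =
      ∫ R, ∫ w, ∫ ω, F R w ω ∂(sphereMeasure : Measure S2) ∂stdGaussian E3 ∂μO := by
    refine integral_integral_swap ?_
    have hm : Measurable fun q : (E3 × O3) × S2 => F q.1.2 q.1.1 q.2 :=
      measurable_kernelIntegrand_haarRot hψ v (continuous_snd.comp continuous_fst)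
        (continuous_fst.comp continuous_fst) continuous_snd
    refine ((((integrable_one_add_norm_mul_exp_sq_div_four_stdGaussian (E := E3)).const_mul
      (4 * C * ((1 + ‖v‖) * Real.exp (‖v‖ ^ 2 / 4)))).mul_const ((sphereMeasure : Measure S2).real univ)).comp_fst
      μO).mono' (hm.stronglyMeasurable.integral_prod_right'
        (ν := (sphereMeasure : Measure S2))).aestronglyMeasurable (Eventually.of_forall fun q => ?_)
    exact norm_integral_le_of_norm_le_const (Eventually.of_forall fun ω => by
      rw [Real.norm_eq_abs]; exact hFb q.2 q.1 ω)
  have h4 : ∀ R : O3, ∫ w, ∫ ω, F R w ω ∂(sphereMeasure : Measure S2) ∂stdGaussian E3 =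
      hardSphereLinearizedOp ψ (haarRot R v) := by
    intro R
    rw [← hardSphereLinearizedOp_comp_linearIsometryEquiv_apply (haarRot R) ψ v]
    rfl
  obtain ⟨M, hM⟩ := exists_abs_hardSphereLinearizedOp_le_on_sphere hψ hC ‖v‖
  have h5 := integral_haar_comp_eq_sphereAvg (measurable_hardSphereLinearizedOp_of_gaussGrowth hψ hC) v
    (M := M) fun ω => hM _ (by rw [norm_smul, norm_norm, norm_eq_of_mem_sphere ω, mul_one])
  rw [h1]; simp_rw [h2]; rw [h3]; simp_rw [h4, h5]
  rfl

/-- **Registered helper `t12_hardSphereLinearizedOp_zonalAvg_comm`** (Z1 of the corrector plan):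
the zonal (`ℓ = 0`) average `Π₀ψ(u) = (4π)⁻¹∫_{S²} ψ(|u|ω) dσ(ω)` commutes with the linearised
hard-sphere operator on measurable functions of Gaussian growth, `L(Π₀ψ)(v) = Π₀(Lψ)(v)` for every
`v` — so that the sector equations `ℓ = 0` / `ℓ ≥ 1` of `L ψ = g` decouple exactly. (Stated with
`zonalAvg` unfolded.) [folklore] -/
theorem t12_hardSphereLinearizedOp_zonalAvg_comm : ∀ (ψ : EuclideanSpace ℝ (Fin 3) → ℝ) (C : ℝ), Measurable ψ → (∀ x, |ψ x| ≤ C * Real.exp (‖x‖ ^ 2 / 4)) → ∀ v : EuclideanSpace ℝ (Fin 3), Literature.Analysis.UnboundedOperators.hardSphereLinearizedOp (fun u : EuclideanSpace ℝ (Fin 3) => (4 * Real.pi)⁻¹ * ∫ ω : Metric.sphere (0 : EuclideanSpace ℝ (Fin 3)) 1, ψ (‖u‖ • (ω : EuclideanSpace ℝ (Fin 3))) ∂Literature.MathematicalPhysics.KineticTheory.sphereMeasure) v = (4 * Real.pi)⁻¹ * ∫ ω : Metric.sphere (0 : EuclideanSpace ℝ (Fin 3)) 1, Literature.Analysis.UnboundedOperators.hardSphereLinearizedOp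 ψ (‖v‖ • (ω : EuclideanSpace ℝ (Fin 3))) ∂Literature.MathematicalPhysics.KineticTheory.sphereMeasure :=
  fun _ _ hψ hC v => hardSphereLinearizedOp_zonalAvg hψ hC v

/-! ### Z1': radial in, radial out -/

/-- **Registered helper `t12_hardSphereLinearizedOp_radial`** (Z1'): the linearised hard-sphere
operator maps radial functions to radial functions, `|v| = |v'| ⟹ Lψ(v) = Lψ(v')` for every radial
`ψ` (no growth or measurability hypothesis: `ψ ∘ A = ψ` for the reflection `A` exchanging `v, v'`,
and `L(ψ ∘ A) = (Lψ) ∘ A`). [folklore] -/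
theorem t12_hardSphereLinearizedOp_radial : ∀ (ψ : EuclideanSpace ℝ (Fin 3) → ℝ), (∀ u u' : EuclideanSpace ℝ (Fin 3), ‖u‖ = ‖u'‖ → ψ u = ψ u') → ∀ v v' : EuclideanSpace ℝ (Fin 3), ‖v‖ = ‖v'‖ → Literature.Analysis.UnboundedOperators.hardSphereLinearizedOp ψ v = Literature.Analysis.UnboundedOperators.hardSphereLinearizedOp ψ v' := by
  intro ψ hψ v v' h
  have hA : ψ ∘ ((ℝ ∙ (v - v'))ᗮ.reflection) = ψ :=
    funext fun u => hψ _ _ (LinearIsometryEquiv.norm_map _ _)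
  rw [← Submodule.reflection_sub h, ← hardSphereLinearizedOp_comp_linearIsometryEquiv_apply, hA]

/-- `zonalAvg` form of Z1': for radial `ψ`, `Π₀(Lψ) = Lψ` (no hypothesis: `Lψ` is constant on
the sphere `|u| = |v|`). [folklore] -/
theorem zonalAvg_hardSphereLinearizedOp_radial {ψ : E3 → ℝ} (hψ : ∀ u u' : E3, ‖u‖ = ‖u'‖ → ψ u = ψ u')
    (v : E3) : zonalAvg (hardSphereLinearizedOp ψ) v = hardSphereLinearizedOp ψ v :=
  (zonalAvg_congr (ψ₂ := fun _ => hardSphereLinearizedOp ψ v) fun ω =>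
    t12_hardSphereLinearizedOp_radial ψ hψ _ _
      (by rw [norm_smul, norm_norm, norm_eq_of_mem_sphere ω, mul_one])).trans (zonalAvg_const _ v)

end Summit.AtomisticToContinuum.HydrodynamicLimit.Theorems.ClampedCorrectorBirth
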